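import Literature.AlgebraicGeometry.HodgeTheory.HypersurfaceJacobian
import Literature.AlgebraicGeometry.HodgeTheory.HypersurfaceResidueFormsProofs
import HarnessLib

/-!
# `p_g ≥ 1` for smooth hypersurfaces of degree `d ≥ m + 2` — discharge

Sibling proofs file of `HypersurfaceGeometricGenus.lean` (family `hodge`, layer
`Literature/AlgebraicGeometry/HodgeTheory`), discharging its named fact, and with it the original
fact of `HypersurfaceHolomorphicForms.lean` that it refines:

| named fact                                                                                  | discharged by                                               |
|---------------------------------------------------------------------------------------------|-------------------------------------------------------------|
| `Literature.AlgebraicGeometry.HodgeTheory.Hartshorne1977_hypersurface_geometricGenus_pos`      | `Hartshorne1977_hypersurface_geometricGenus_pos_holds`      |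
| `Literature.AlgebraicGeometry.HodgeTheory.Hartshorne1977_hypersurface_exists_holomorphicTopForm` | `Hartshorne1977_hypersurface_exists_holomorphicTopForm_holds` |

In print (Hartshorne, *Algebraic Geometry*, II Example 8.20.3, book p. 184): for a nonsingular
hypersurface `Y` of degree `d` in `ℙⁿ`, "`ω_Y ≅ 𝒪_Y(d-n-1)` […] `n` arbitrary, `d ≥ n + 1` […]
Hence `p_g(Y) ≥ 1`", transported to the analytification by Serre's GAGA (App. B, Thm. 2.1,
book p. 440). The tree proves the analytic statement directly, by the programme laid out in
`HypersurfaceResidueForms` (every step PROVED, by the `hodge` literature agents):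

* (L1) the Jacobian criterion, `Hartshorne1977_smoothHypersurface_jacobian_holds`
  (`HypersurfaceJacobian`: smooth ⟹ regular stalks; a singular point of `k[x]/(f)` has a
  non-regular local ring, Matsumura Thm. 14.2, `Resolution/RegularLocalRingsJacobian`);
* (L2) Griffiths' residue form on a holomorphic model, `Voisin2003_hypersurface_residueForm_holds`
  (`HypersurfaceResidueFormsProofs`, assembling `HypersurfaceResidueFormDef`,
  `HypersurfaceResidueFormHolomorphic`, `HypersurfaceResidueFormNonzero`);
* the proved reductions `Hartshorne1977_hypersurface_geometricGenus_pos_of (L1) (L2)`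
  (`HypersurfaceResidueForms`; in `HypersurfaceResidueFormsProofs` with (L2) fed:
  `Hartshorne1977_hypersurface_geometricGenus_pos_of_jacobian`) and
  `Hartshorne1977_hypersurface_exists_holomorphicTopForm_of_geometricGenus_pos`
  (`HypersurfaceGeometricGenus`: a holomorphic `m`-form on an `m`-fold is smooth, closed and of
  type `(m,0)`).

This file only feeds (L1) into these reductions.

## References

* R. Hartshorne, *Algebraic Geometry* (1977), II Prop. 8.20, Example 8.20.3; App. B Thm. 2.1.
* C. Voisin, *Hodge Theory and Complex Algebraic Geometry II* (2003), §6.1.1, §6.1.3, Thm. 6.10,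
  Cor. 6.12.
* J.-P. Serre, *Géométrie algébrique et géométrie analytique*, Ann. Inst. Fourier 6 (1956), §3.
-/

noncomputable section

namespace Literature.AlgebraicGeometry.HodgeTheory

/-- Discharge of the named fact `Hartshorne1977_hypersurface_geometricGenus_pos`: **every Hodge
model of a smooth hypersurface `Y ⊂ ℙ^{m+1}_ℂ` of degree `d ≥ m + 2` (`m ≥ 1`) carries a non-zero
complex `m`-form holomorphic in charts** — Hartshorne II, Example 8.20.3 (`ω_Y ≅ 𝒪_Y(d-m-2)`,
`p_g(Y) ≥ 1`) read on the analytification through GAGA (App. B, Thm. 2.1). Proof: the reduction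
`Hartshorne1977_hypersurface_geometricGenus_pos_of_jacobian` (Jacobian criterion ⟹ the fact, the
residue-form leaf being discharged) applied to `Hartshorne1977_smoothHypersurface_jacobian_holds`.
[cite: Hartshorne1977, II Example 8.20.3 and App. B Thm. 2.1] [cite: VoisinHodgeII2003, §6.1.3] -/
theorem Hartshorne1977_hypersurface_geometricGenus_pos_holds :
    Hartshorne1977_hypersurface_geometricGenus_pos :=
  Hartshorne1977_hypersurface_geometricGenus_pos_of_jacobian
    Hartshorne1977_smoothHypersurface_jacobian_holds

/-- Discharge of the named fact `Hartshorne1977_hypersurface_exists_holomorphicTopForm`: **every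
Hodge model of a smooth hypersurface `Y ⊂ ℙ^{m+1}_ℂ` of degree `d ≥ m + 2` carries a smooth,
closed, non-zero complex `m`-form of type `(m,0)`** (Hartshorne II, Example 8.20.3: `p_g(Y) ≥ 1`;
Voisin II, §6.1.3: the residues `Res_Y(PΩ/F)`). Proof:
`Hartshorne1977_hypersurface_exists_holomorphicTopForm_of_geometricGenus_pos` applied to
`Hartshorne1977_hypersurface_geometricGenus_pos_holds`.
[cite: Hartshorne1977, II Example 8.20.3] [cite: VoisinHodgeII2003, §6.1.3 and Cor. 6.12 (p = 1)] -/
theorem Hartshorne1977_hypersurface_exists_holomorphicTopForm_holds :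
    Hartshorne1977_hypersurface_exists_holomorphicTopForm :=
  Hartshorne1977_hypersurface_exists_holomorphicTopForm_of_geometricGenus_pos
    Hartshorne1977_hypersurface_geometricGenus_pos_holds

end Literature.AlgebraicGeometry.HodgeTheory

end
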